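import Literature.NumberTheory.NumberFields.ArithmeticEquivalenceGassmannProofs
import Literature.NumberTheory.LFunctions.DedekindZetaProofs
import Literature.NumberTheory.LFunctions.AbelianFieldDedekindZeta
import Literature.NumberTheory.LFunctions.DedekindZeta
import Mathlib.GroupTheory.Sylow
import Mathlib.GroupTheory.IndexNormal
import Mathlib.GroupTheory.Perm.Cycle.Type
import Mathlib.GroupTheory.SpecificGroups.Cyclic
import Mathlib.NumberTheory.EulerProduct.DirichletLSeries
import HarnessLib

/-!
# Dedekind's relation `ζ_N · ζ² = ζ_k · ζ_K²` for an `S₃`-sextic (stub `stub_dedekindRelation`)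

For a Galois number field `N/ℚ` of degree `6` with non-abelian group `G` (so `G ≅ S₃`), a cubic
subfield `K = N^{H_K}` (`|H_K| = 2`) and a quadratic subfield `k = N^{H_k}` (`|H_k| = 3`), the
Dirichlet series satisfy `ζ_N(s) ζ(s)² = ζ_k(s) ζ_K(s)²` on `re s > 1`.

Proof (Artin-free): both sides are Euler products over the rational primes, and at each `p` the
factors agree by the multiset identity `T_N + {1, 1} = T_k + T_K + T_K` of splitting types,
which follows (`eq_of_forall_sum_filter_dvd_eq`) from Perlis' counting identity (★)
`card_inertia_mul_card_fixingSubgroup_mul_sum` and the identity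
`3·c_⊥(x) + c_⊤(x) = c_A(x) + 3·c_C(x)` (`c_H(x) = #{g : g x g⁻¹ ∈ H}`, `|A| = 3`, `|C| = 2`) in
a non-abelian group of order `6`.
-/

noncomputable section

open scoped NumberField nonZeroDivisors
open Literature.NumberTheory.LFunctions Literature.NumberTheory.LFunctions.NumberField

namespace Summit.QuantumAdvantage.QuantumAdvantage.Theorems.DegreeOnePrimesEscape

/-! ## 1. The finite-group identity in a non-abelian group of order `6` -/

section GroupLemma

variable {G : Type*} [Group G]

/-- `c_H(x) = |G|` when every conjugate of `x` lies in `H`. -/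
private theorem card_conj_mem_eq_card_of_forall [Finite G] (H : Subgroup G) (x : G)
    (h : ∀ g : G, g * x * g⁻¹ ∈ H) : Nat.card {g : G // g * x * g⁻¹ ∈ H} = Nat.card G :=
  Nat.card_congr (Equiv.subtypeUnivEquiv h)

/-- `c_H(x) = 0` when no conjugate of `x` lies in `H`. -/
private theorem card_conj_mem_eq_zero_of_forall (H : Subgroup G) (x : G)
    (h : ∀ g : G, g * x * g⁻¹ ∉ H) : Nat.card {g : G // g * x * g⁻¹ ∈ H} = 0 := by
  rw [Nat.card_eq_zero]
  exact Or.inl ⟨fun g => h g.1 g.2⟩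

/-- A group with two non-commuting elements is not cyclic. -/
private theorem not_isCyclic_of_exists_ne [Finite G] (hna : ∃ g h : G, g * h ≠ h * g) :
    ¬ IsCyclic G := fun hc => by
  obtain ⟨g, h, hne⟩ := hna
  exact hne (hc.isMulCommutative.is_comm.comm g h)

/-- In a non-abelian group of order `6`, a non-identity element has order `2` or `3`. -/
private theorem orderOf_eq_two_or_three [Finite G] (h6 : Nat.card G = 6)
    (hna : ∃ g h : G, g * h ≠ h * g) {x : G} (hx1 : x ≠ 1) : orderOf x = 2 ∨ orderOf x = 3 := by
  have hdvd : orderOf x ∣ 6 := h6 ▸ orderOf_dvd_natCard x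
  have hne1 : orderOf x ≠ 1 := fun h => hx1 (orderOf_eq_one_iff.mp h)
  have hne6 : orderOf x ≠ 6 := fun h =>
    not_isCyclic_of_exists_ne hna (isCyclic_of_orderOf_eq_card x (h.trans h6.symm))
  have hmem : orderOf x ∈ Nat.divisors 6 := Nat.mem_divisors.mpr ⟨hdvd, by norm_num⟩
  have h6d : Nat.divisors 6 = {1, 2, 3, 6} := by decide
  rw [h6d] at hmem
  simp only [Finset.mem_insert, Finset.mem_singleton] at hmem
  omega

/-- In a non-abelian group of order `6`, an involution has centralizer of order `2`. -/
private theorem card_centralizer_eq_two [Finite G] (h6 : Nat.card G = 6)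
    (hna : ∃ g h : G, g * h ≠ h * g) {x : G} (h2 : orderOf x = 2) :
    Nat.card (Subgroup.centralizer ({x} : Set G)) = 2 := by
  set Z := Subgroup.centralizer ({x} : Set G)
  have hxZ : Subgroup.zpowers x ≤ Z := by
    rw [Subgroup.zpowers_le]
    exact Subgroup.mem_centralizer_singleton_iff.mpr rfl
  have h2dvd : 2 ∣ Nat.card Z := by
    have := Subgroup.card_dvd_of_le hxZ
    rwa [Nat.card_zpowers, h2] at this
  have hdvd6 : Nat.card Z ∣ 6 := h6 ▸ Z.card_subgroup_dvd_card
  have hne6 : Nat.card Z ≠ 6 := fun hZ6 => by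
    have hZtop : Z = ⊤ := Subgroup.eq_top_of_card_eq Z (hZ6.trans h6.symm)
    obtain ⟨y, hy⟩ := exists_prime_orderOf_dvd_card' (G := G) 3 (by rw [h6]; norm_num)
    have hcomm : Commute x y := by
      have hyZ : y ∈ Z := hZtop ▸ Subgroup.mem_top y
      exact (Subgroup.mem_centralizer_singleton_iff.mp hyZ).symm
    have hord : orderOf (x * y) = 6 := by
      rw [hcomm.orderOf_mul_eq_mul_orderOf_of_coprime (by rw [h2, hy]; norm_num), h2, hy]
    exact not_isCyclic_of_exists_ne hna (isCyclic_of_orderOf_eq_card (x * y) (hord.trans h6.symm))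
  obtain ⟨k, hk⟩ := h2dvd
  have hk3 : k ∣ 3 := by
    have : 2 * k ∣ 2 * 3 := hk ▸ hdvd6
    exact (Nat.mul_dvd_mul_iff_left (by norm_num)).mp this
  rcases (Nat.dvd_prime Nat.prime_three).mp hk3 with rfl | rfl
  · simpa using hk
  · exact absurd hk hne6

/-- In a non-abelian group of order `6`, every involution is conjugate into any subgroup of
order `2` (Sylow). -/
private theorem exists_conj_mem_of_card_eq_two [Finite G] (h6 : Nat.card G = 6) (C : Subgroup G)
    (hC : Nat.card C = 2) {x : G} (h2 : orderOf x = 2) : ∃ g : G, g * x * g⁻¹ ∈ C := by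
  have hPcard : Nat.card (Subgroup.zpowers x) = 2 ^ 1 := by rw [Nat.card_zpowers, h2, pow_one]
  have hCcard : Nat.card C = 2 ^ 1 := by rw [hC, pow_one]
  have hidx : ∀ H : Subgroup G, Nat.card H = 2 ^ 1 → ¬ 2 ∣ H.index := fun H hH hdvd => by
    have := H.card_mul_index
    rw [hH, h6, pow_one] at this
    omega
  let P : Sylow 2 G := (IsPGroup.of_card hPcard).toSylow (hidx _ hPcard)
  let Q : Sylow 2 G := (IsPGroup.of_card hCcard).toSylow (hidx _ hCcard)
  obtain ⟨g, hg⟩ := MulAction.exists_smul_eq G P Q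
  refine ⟨g, ?_⟩
  have hxP : x ∈ (P : Subgroup G) := Subgroup.mem_zpowers x
  have h := Subgroup.smul_mem_pointwise_smul x (MulAut.conj g) (P : Subgroup G) hxP
  rw [← Sylow.coe_subgroup_smul, hg] at h
  exact h

/-- **The finite-group identity behind Dedekind's relation.** In a non-abelian group `G` of
order `6`, for subgroups `A` of order `3` and `C` of order `2` and every `x ∈ G`:
`3·c_⊥(x) + c_⊤(x) = c_A(x) + 3·c_C(x)`, where `c_H(x) = #{g ∈ G : g x g⁻¹ ∈ H}` (so
`c_⊤(x) = |G|`; this is the permutation-character identity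
`Ind_1 1 + 2·Ind_G 1 = Ind_A 1 + 2·Ind_C 1` of `S₃`, multiplied by `|C_G(x)|`). -/
private theorem three_mul_card_conj_bot_add [Finite G] (h6 : Nat.card G = 6)
    (hna : ∃ g h : G, g * h ≠ h * g) (A C : Subgroup G) (hA : Nat.card A = 3)
    (hC : Nat.card C = 2) (x : G) :
    3 * Nat.card {g : G // g * x * g⁻¹ ∈ (⊥ : Subgroup G)} + Nat.card G =
      Nat.card {g : G // g * x * g⁻¹ ∈ A} + 3 * Nat.card {g : G // g * x * g⁻¹ ∈ C} := by
  classical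
  have hordA : ∀ y ∈ A, orderOf y ∣ 3 := fun y hy => by
    rw [← hA, ← Subgroup.orderOf_mk y hy]
    exact orderOf_dvd_natCard _
  have hordC : ∀ y ∈ C, orderOf y ∣ 2 := fun y hy => by
    rw [← hC, ← Subgroup.orderOf_mk y hy]
    exact orderOf_dvd_natCard _
  rw [h6]
  by_cases hx1 : x = 1
  · subst hx1
    have h1 : ∀ (H : Subgroup G) (g : G), g * 1 * g⁻¹ ∈ H := fun H g => by
      rw [mul_one, mul_inv_cancel]
      exact one_mem H
    rw [card_conj_mem_eq_card_of_forall ⊥ 1 (h1 ⊥), card_conj_mem_eq_card_of_forall A 1 (h1 A),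
      card_conj_mem_eq_card_of_forall C 1 (h1 C), h6]
  rw [card_conj_mem_eq_zero_of_forall ⊥ x
    (fun g hg => hx1 (conj_eq_one_iff.mp (Subgroup.mem_bot.mp hg))), mul_zero, zero_add]
  have hordconj : ∀ g : G, orderOf (g * x * g⁻¹) = orderOf x := fun g =>
    (MulAut.conj g).orderOf_eq x
  rcases orderOf_eq_two_or_three h6 hna hx1 with h2 | h3
  · -- `x` is an involution: `c_A(x) = 0`, `c_C(x) = 2`
    rw [card_conj_mem_eq_zero_of_forall A x fun g hg => by
      have := hordA _ hg
      rw [hordconj, h2] at this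
      exact absurd this (by norm_num)]
    rw [Literature.NumberTheory.NumberFields.card_conj_mem_eq C x,
      card_centralizer_eq_two h6 hna h2]
    suffices hone : Nat.card {h : C // IsConj x (h : G)} = 1 by rw [hone]
    obtain ⟨g₀, hg₀⟩ := exists_conj_mem_of_card_eq_two h6 C hC h2
    obtain ⟨c, -, hc⟩ := (Nat.card_eq_two_iff' (1 : C)).mp hC
    have hne : ∀ a : {h : C // IsConj x (h : G)}, a.1 ≠ 1 := fun a ha => by
      have := a.2
      rw [ha, OneMemClass.coe_one, isConj_one_left] at this
      exact hx1 this
    rw [Nat.card_eq_one_iff_unique]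
    exact ⟨⟨fun a b => Subtype.ext ((hc _ (hne a)).trans (hc _ (hne b)).symm)⟩,
      ⟨⟨⟨g₀ * x * g₀⁻¹, hg₀⟩, isConj_iff.mpr ⟨g₀, rfl⟩⟩⟩⟩
  · -- `x` has order `3`: `x ∈ A ⊴ G`, `c_A(x) = 6`, `c_C(x) = 0`
    have hidx : A.index = 2 := by
      have := A.card_mul_index
      rw [hA, h6] at this
      omega
    haveI hAn : A.Normal := Subgroup.normal_of_index_eq_two hidx
    have hxA : x ∈ A := by
      have hq2 : (QuotientGroup.mk x : G ⧸ A) ^ 2 = 1 := by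
        rw [← hidx, Subgroup.index_eq_card]
        exact pow_card_eq_one'
      have hq3 : (QuotientGroup.mk x : G ⧸ A) ^ 3 = 1 := by
        rw [← QuotientGroup.mk_pow, ← h3, pow_orderOf_eq_one, QuotientGroup.mk_one]
      have hq : (QuotientGroup.mk x : G ⧸ A) = 1 := by
        calc (QuotientGroup.mk x : G ⧸ A)
            = (QuotientGroup.mk x : G ⧸ A) ^ 2 * QuotientGroup.mk x := by rw [hq2, one_mul]
          _ = (QuotientGroup.mk x : G ⧸ A) ^ 3 := (pow_succ _ 2).symm
          _ = 1 := hq3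
      exact (QuotientGroup.eq_one_iff x).mp hq
    rw [card_conj_mem_eq_card_of_forall A x (fun g => hAn.conj_mem x hxA g), h6,
      card_conj_mem_eq_zero_of_forall C x fun g hg => by
        have := hordC _ hg
        rw [hordconj, h3] at this
        exact absurd this (by norm_num)]

end GroupLemma

/-! ## 2. The splitting types of `p` in `N`, `K`, `k`: Perlis' identity (★) + the group identity -/

section Arithmetic

open Ideal NumberField Literature.NumberTheory.NumberFields IsDedekindDomain

variable {N : Type*} [Field N] [NumberField N] [IsGalois ℚ N]

/-- Arithmetic of the assembly: `3·(n·a) + n·6 = n·(3b) + 3·(n·(2c))` with `n > 0` gives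
`a + 2 = b + 2c`. -/
private theorem arith_of_sums {n a b c : ℕ} (hn : 0 < n)
    (h : 3 * (n * a) + n * 6 = n * (3 * b) + 3 * (n * (2 * c))) : a + 2 = b + 2 * c := by
  refine Nat.eq_of_mul_eq_mul_left (Nat.mul_pos (by norm_num : 0 < 3) hn) ?_
  calc 3 * n * (a + 2) = 3 * (n * a) + n * 6 := by ring
    _ = n * (3 * b) + 3 * (n * (2 * c)) := h
    _ = 3 * n * (b + 2 * c) := by ring

/-- **The sums `Σ_{f ∈ T, f ∣ m} f` of the three splitting types.** For `N/ℚ` Galois of degree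
`6` with non-abelian group, `K` a cubic and `k` a quadratic subfield, every prime `p` and every
`m`: `A_N(m) + 2 = A_k(m) + 2·A_K(m)` where `A_E(m) = Σ_{P ∣ p in E, f(P|p) ∣ m} f(P|p)`
(Perlis' counting identity (★) `card_inertia_mul_card_fixingSubgroup_mul_sum` for `E = N, k, K`,
summed against the group identity `three_mul_card_conj_bot_add` over the coset `φ^m I`). -/
private theorem sum_splittingType_top_add_two (h6 : Module.finrank ℚ N = 6)
    (hna : ∃ g h : N ≃ₐ[ℚ] N, g * h ≠ h * g) (K k : IntermediateField ℚ N)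
    (hK : Module.finrank ℚ K = 3) (hk : Module.finrank ℚ k = 2) {p : ℕ} (hp : p.Prime) (m : ℕ) :
    ((splittingType (⊤ : IntermediateField ℚ N) p).map fun f => if f ∣ m then f else 0).sum + 2 =
      ((splittingType k p).map fun f => if f ∣ m then f else 0).sum +
        2 * ((splittingType K p).map fun f => if f ∣ m then f else 0).sum := by
  classical
  haveI := Fact.mk hp
  haveI h𝔭max : (span {(p : ℤ)}).IsMaximal := Int.ideal_span_isMaximal_of_prime p
  have hp𝔭 : (span {(p : ℤ)}) ≠ ⊥ := by
    rw [Ne, span_singleton_eq_bot]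
    exact_mod_cast hp.ne_zero
  haveI : IsGaloisGroup (N ≃ₐ[ℚ] N) ℤ (𝓞 N) := IsGaloisGroup.of_isFractionRing _ _ _ ℚ N
  -- a prime of `N` above `p` and a Frobenius there
  obtain ⟨Q₀, hQ₀max, hQ₀over⟩ :=
    Ideal.exists_maximal_ideal_liesOver_of_isIntegral (S := 𝓞 N) (span {(p : ℤ)})
  haveI := hQ₀max
  haveI := hQ₀over
  haveI : Finite (𝓞 N ⧸ Q₀) :=
    Ideal.finiteQuotientOfFreeOfNeBot Q₀ (ne_bot_of_liesOver_of_ne_bot hp𝔭 Q₀)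
  obtain ⟨φ, hφ⟩ := IsArithFrobAt.exists_of_isInvariant ℤ (N ≃ₐ[ℚ] N) Q₀
  letI : Fintype (Q₀.inertia (N ≃ₐ[ℚ] N)) := Fintype.ofFinite _
  -- the group data: `|G| = 6`, `|H_K| = 2`, `|H_k| = 3`, `H_N = 1`
  have hG : Nat.card (N ≃ₐ[ℚ] N) = 6 := (IsGalois.card_aut_eq_finrank ℚ N).trans h6
  have hHK : Nat.card K.fixingSubgroup = 2 := by
    rw [IsGalois.card_fixingSubgroup_eq_finrank K]
    have := Module.finrank_mul_finrank ℚ K N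
    rw [hK, h6] at this
    omega
  have hHk : Nat.card k.fixingSubgroup = 3 := by
    rw [IsGalois.card_fixingSubgroup_eq_finrank k]
    have := Module.finrank_mul_finrank ℚ k N
    rw [hk, h6] at this
    omega
  -- (★) for the three fields
  have sT := card_inertia_mul_card_fixingSubgroup_mul_sum (⊤ : IntermediateField ℚ N) hp Q₀ hφ m
  have sk := card_inertia_mul_card_fixingSubgroup_mul_sum k hp Q₀ hφ m
  have sK := card_inertia_mul_card_fixingSubgroup_mul_sum K hp Q₀ hφ m
  rw [card_pairs_eq_sum, IntermediateField.fixingSubgroup_top, Subgroup.card_bot, one_mul] at sT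
  rw [card_pairs_eq_sum, hHk] at sk
  rw [card_pairs_eq_sum, hHK] at sK
  -- the group identity at `x = φ^m τ`, summed over `τ ∈ I`
  have hsum := Finset.sum_congr rfl fun (τ : Q₀.inertia (N ≃ₐ[ℚ] N)) (_ : τ ∈ Finset.univ) =>
    three_mul_card_conj_bot_add hG hna k.fixingSubgroup K.fixingSubgroup hHk hHK (φ ^ m * τ)
  rw [Finset.sum_add_distrib, Finset.sum_add_distrib, Finset.sum_const, Finset.card_univ,
    smul_eq_mul, ← Nat.card_eq_fintype_card, ← Finset.mul_sum, ← Finset.mul_sum, ← sT, ← sk,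
    ← sK, hG] at hsum
  exact arith_of_sums Nat.card_pos hsum

/-- **The multiset identity of splitting types in an `S₃`-sextic**: for every prime `p`,
`splittingType N p + {1, 1} = splittingType k p + splittingType K p + splittingType K p`
(the sums `Σ_{f ∣ m} f` agree for every `m` by `sum_splittingType_top_add_two`, and these sums
determine a multiset of positive integers, `eq_of_forall_sum_filter_dvd_eq`). -/
private theorem splittingType_add_replicate_eq (h6 : Module.finrank ℚ N = 6)
    (hna : ∃ g h : N ≃ₐ[ℚ] N, g * h ≠ h * g) (K k : IntermediateField ℚ N)
    (hK : Module.finrank ℚ K = 3) (hk : Module.finrank ℚ k = 2) {p : ℕ} (hp : p.Prime) :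
    splittingType N p + Multiset.replicate 2 1 =
      splittingType k p + (splittingType K p + splittingType K p) := by
  have htop : splittingType (⊤ : IntermediateField ℚ N) p = splittingType N p :=
    splittingType_eq_of_ringEquiv (NumberField.RingOfIntegers.mapRingEquiv
      (IntermediateField.topEquiv (F := ℚ) (E := N)).toRingEquiv) hp
  refine eq_of_forall_sum_filter_dvd_eq _ _ _ rfl ?_ ?_ ?_
  · intro f hf
    rcases Multiset.mem_add.mp hf with h | h
    · exact splittingType_pos hp h
    · rw [Multiset.eq_of_mem_replicate h]
      exact Nat.one_pos
  · intro f hf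
    rcases Multiset.mem_add.mp hf with h | h
    · exact splittingType_pos hp h
    · rcases Multiset.mem_add.mp h with h | h <;> exact splittingType_pos hp h
  · intro m
    rw [← sum_map_ite_dvd, ← sum_map_ite_dvd, Multiset.map_add, Multiset.sum_add, Multiset.map_add,
      Multiset.map_add, Multiset.sum_add, Multiset.sum_add, ← htop, Multiset.map_replicate,
      Multiset.sum_replicate, if_pos (one_dvd m), smul_eq_mul, mul_one,
      sum_splittingType_top_add_two h6 hna K k hK hk hp m]
    ring

end Arithmetic

/-! ## 3. Euler products regrouped along the rational prime below -/

section Euler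

open Ideal NumberField Literature.NumberTheory.NumberFields IsDedekindDomain

/-- The Euler factor of `ζ_K` at `p`, as a product over the splitting type of `p` in `K`:
`∏_{v ∣ p} (1 - N(v)^{-s})⁻¹ = ∏_{f ∈ splittingType K p} (1 - p^{-fs})⁻¹`. -/
private theorem prod_fiber_dedekindEulerFactor_eq_prod_map (K : Type*) [Field K] [NumberField K]
    (p : Nat.Primes) (s : ℂ) :
    ∏ v : {v : HeightOneSpectrum (𝓞 K) // primeBelow v = p}, dedekindEulerFactor K v.1 s =
      ((splittingType K p).map fun f : ℕ => (1 - (((p : ℕ) : ℂ) ^ (-s)) ^ f)⁻¹).prod := by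
  have h1 : ∏ v : {v : HeightOneSpectrum (𝓞 K) // primeBelow v = p}, dedekindEulerFactor K v.1 s =
      ∏ v : {v : HeightOneSpectrum (𝓞 K) // primeBelow v = p},
        (fun f : ℕ => (1 - (((p : ℕ) : ℂ) ^ (-s)) ^ f)⁻¹) (v.1.asIdeal.inertiaDeg ℤ) := by
    refine Finset.prod_congr rfl fun v _ => ?_
    rw [dedekindEulerFactor, absNorm_eq_pow_inertiaDeg v, Nat.cast_pow,
      ← Complex.natCast_cpow_natCast_mul, Complex.cpow_nat_mul]
  rw [h1, AbelianSplitting.prod_fiber_eq_prod_map_splittingType p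
    (fun f : ℕ => (1 - (((p : ℕ) : ℂ) ^ (-s)) ^ f)⁻¹)]

/-- **`ζ_K(s) = ∏_p ∏_{f ∈ splittingType K p} (1 - p^{-fs})⁻¹`** for `re s > 1`: the Euler
product of the Dedekind zeta function (`hasProd_dedekindEulerFactor_holds`) regrouped along the
rational prime below (`Equiv.sigmaFiberEquiv primeBelow`, `HasProd.sigma`). -/
private theorem hasProd_primes_dedekindZeta (K : Type*) [Field K] [NumberField K] {s : ℂ}
    (hs : 1 < s.re) :
    HasProd (fun p : Nat.Primes =>
      ((splittingType K p).map fun f : ℕ => (1 - (((p : ℕ) : ℂ) ^ (-s)) ^ f)⁻¹).prod)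
      (dedekindZeta K s) := by
  have hD := hasProd_dedekindEulerFactor_holds K hs
  have hD' := (Equiv.hasProd_iff (Equiv.sigmaFiberEquiv (primeBelow (K := K)))).mpr hD
  have hD'' : HasProd (fun p : Nat.Primes ↦
      ∏ v : {v : HeightOneSpectrum (𝓞 K) // primeBelow v = p}, dedekindEulerFactor K v.1 s)
      (dedekindZeta K s) := by
    refine hD'.sigma fun p ↦ ?_
    simpa only [Function.comp_def, Equiv.sigmaFiberEquiv_apply] using
      hasProd_fintype (fun v : {v : HeightOneSpectrum (𝓞 K) // primeBelow v = p} ↦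
        dedekindEulerFactor K v.1 s)
  simpa only [prod_fiber_dedekindEulerFactor_eq_prod_map] using hD''

end Euler

/-- **Dedekind's relation for an `S₃`-sextic** (Dedekind 1900): for a Galois number field `N/ℚ`
of degree `6` with non-abelian group, a cubic subfield `K` and a quadratic subfield `k`,
`ζ_N(s) · ζ(s)² = ζ_k(s) · ζ_K(s)²` for `re s > 1` (Mathlib's Dirichlet series
`NumberField.dedekindZeta`, `riemannZeta`). Both sides are Euler products over the rational
primes whose factors at `p` agree by the multiset identity `splittingType_add_replicate_eq`. -/
theorem stub_dedekindRelation :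
    ∀ (N : Type) [Field N] [NumberField N] [IsGalois ℚ N], Module.finrank ℚ N = 6 →
      (∃ g h : N ≃ₐ[ℚ] N, g * h ≠ h * g) →
      ∀ (K k : IntermediateField ℚ N), Module.finrank ℚ K = 3 → Module.finrank ℚ k = 2 →
      ∀ s : ℂ, 1 < s.re →
        NumberField.dedekindZeta N s * riemannZeta s ^ 2 =
          NumberField.dedekindZeta k s * NumberField.dedekindZeta K s ^ 2 := by
  intro N _ _ _ h6 hna K k hK hk s hs
  set g : Nat.Primes → ℕ → ℂ := fun p f => (1 - (((p : ℕ) : ℂ) ^ (-s)) ^ f)⁻¹ with hg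
  have hN := hasProd_primes_dedekindZeta N hs
  have hK' := hasProd_primes_dedekindZeta K hs
  have hk' := hasProd_primes_dedekindZeta k hs
  have hζ : HasProd (fun p : Nat.Primes => g p 1) (riemannZeta s) := by
    simpa only [hg, pow_one] using riemannZeta_eulerProduct_hasProd hs
  have hL := hN.mul (hζ.mul hζ)
  have hR := hk'.mul (hK'.mul hK')
  have heq : (fun p : Nat.Primes => ((Literature.NumberTheory.NumberFields.splittingType N p).map
        (g p)).prod * (g p 1 * g p 1)) =
      fun p : Nat.Primes => ((Literature.NumberTheory.NumberFields.splittingType k p).map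
        (g p)).prod * (((Literature.NumberTheory.NumberFields.splittingType K p).map (g p)).prod *
          ((Literature.NumberTheory.NumberFields.splittingType K p).map (g p)).prod) := by
    funext p
    have hmult := congrArg (fun T : Multiset ℕ => (T.map (g p)).prod)
      (splittingType_add_replicate_eq h6 hna K k hK hk p.2)
    simp only [Multiset.map_add, Multiset.prod_add, Multiset.map_replicate,
      Multiset.prod_replicate] at hmult
    rw [← hmult]
    ring
  rw [heq] at hL
  rw [sq, sq]
  exact hL.unique hR

/-- **The multiset identity of splitting types in an `S₃`-sextic** (public form of the key step
of `stub_dedekindRelation`, for use prime by prime): for a Galois number field `N/ℚ` of degree `6`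
with non-abelian group, a cubic subfield `K`, a quadratic subfield `k` and EVERY prime `p`
(ramified or not), `splittingType N p + {1, 1} = splittingType k p + splittingType K p +
splittingType K p` (Perlis' splitting types: the multisets of residue degrees of the primes above
`p`, ramification indices ignored). Equivalently, the permutation characters of `S₃` satisfy
`Ind_1 1 + 2·1 = Ind_{A₃} 1 + 2·Ind_{C₂} 1`. -/
theorem splittingType_sextic_add_two_eq (N : Type*) [Field N] [NumberField N] [IsGalois ℚ N]
    (h6 : Module.finrank ℚ N = 6) (hna : ∃ g h : N ≃ₐ[ℚ] N, g * h ≠ h * g)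
    (K k : IntermediateField ℚ N) (hK : Module.finrank ℚ K = 3) (hk : Module.finrank ℚ k = 2)
    {p : ℕ} (hp : p.Prime) :
    Literature.NumberTheory.NumberFields.splittingType N p + Multiset.replicate 2 1 =
      Literature.NumberTheory.NumberFields.splittingType k p +
        (Literature.NumberTheory.NumberFields.splittingType K p +
          Literature.NumberTheory.NumberFields.splittingType K p) :=
  splittingType_add_replicate_eq h6 hna K k hK hk hp

end Summit.QuantumAdvantage.QuantumAdvantage.Theorems.DegreeOnePrimesEscape
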